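import Mathlib
import HarnessLib

/-!
# Nested products of blown-up coordinates: algebra, the sign lemma, monomial factors

(Line `janus-bands`, crux `ArrangementNormalForm`, stub `stub_separateHigh_hH`, part `AllHHNest` of
the dimension-generic wall-invariant termwise-split lemma, base dimension `b + 1 ≥ 4` with fibres;
namespace `SepAll`.)
A nested thin sector of depth `D` at a base point `z₁` is `{z₁ + ∑_l s_l f_l}` with the NESTED
PRODUCTS `s_l = cum w l = w₀ w₁ ⋯ w_l` of the blown-up coordinates `w ∈ (0, δ₀) × ⋯ × (0, δ_{D-1})`
(frame `f`). Along it every affine form takes the NESTED AFFINE VALUE `c₀ + ∑_l cum w l · α l`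
(`α l` = value of its linear part on `f_l`). This file provides:
* the algebra of `cum` (positivity, bounds, behaviour under changing one coordinate, splitting
  `cum w l = cum w r · tailProd w r l` for `r ≤ l`, the `Fin.cons` recursion);
* THE SIGN LEMMA (`sign_nest`, `sign_nest_family`, registered as `separateAllHH_nest`): the first
  non-zero coefficient among `c₀, α 0, α 1, …` decides the sign of the nested affine value on all
  boxes `∏ (0, ρ]` with `ρ` small; finitely many forms are, on a common small box, either all
  positive or one of them is non-positive — so a small nested sector lies inside the base
  polyhedron or misses it;
* THE MONOMIAL FACTOR (`nest_factor`, `unitOf_bounds`): if `α l = 0` for `l < r` then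
  `∑_l cum w l · α l = cum w r · unitOf α r w` with a polynomial factor `unitOf` equal to `α r` at
  the corner and two-sided bounded near it — every wall through `z₁` is a monomial in the chart.
-/

noncomputable section

open Set Finset

namespace Summit.KontsevichZagierPeriods.ArrangementNormalForm.JanusBands

namespace SepAll

variable {D : ℕ}

/-! ### Nested products -/

/-- The nested product `w₀ w₁ ⋯ w_l`. -/
def cum (w : Fin D → ℝ) (l : Fin D) : ℝ := ∏ j, if j ≤ l then w j else 1

/-- The partial product `∏_{r < j ≤ l} w_j`. -/
def tailProd (w : Fin D → ℝ) (r l : Fin D) : ℝ := ∏ j, if r < j ∧ j ≤ l then w j else 1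

/-- Nested products are positive on the positive orthant. -/
theorem cum_pos {w : Fin D → ℝ} (hw : ∀ j, 0 < w j) (l : Fin D) : 0 < cum w l :=
  prod_pos fun j _ => by split_ifs <;> [exact hw j; exact one_pos]

/-- Nested products are non-negative on the closed positive orthant. -/
theorem cum_nonneg {w : Fin D → ℝ} (hw : ∀ j, 0 ≤ w j) (l : Fin D) : 0 ≤ cum w l :=
  prod_nonneg fun j _ => by split_ifs <;> [exact hw j; exact zero_le_one]

/-- Partial products are non-negative on the closed positive orthant. -/
theorem tailProd_nonneg {w : Fin D → ℝ} (hw : ∀ j, 0 ≤ w j) (r l : Fin D) : 0 ≤ tailProd w r l :=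
  prod_nonneg fun j _ => by split_ifs <;> [exact hw j; exact zero_le_one]

/-- **Splitting a nested product** at an earlier level. -/
theorem cum_eq_mul_tailProd (w : Fin D → ℝ) {r l : Fin D} (h : r ≤ l) :
    cum w l = cum w r * tailProd w r l := by
  unfold cum tailProd
  rw [← prod_mul_distrib]
  refine prod_congr rfl fun j _ => ?_
  by_cases h1 : j ≤ r
  · have h2 : j ≤ l := h1.trans h
    have h3 : ¬(r < j ∧ j ≤ l) := fun hh => absurd (lt_of_le_of_lt h1 hh.1) (lt_irrefl _)
    rw [if_pos h1, if_pos h2, if_neg h3, mul_one]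
  · by_cases h2 : j ≤ l
    · have h3 : r < j ∧ j ≤ l := ⟨lt_of_not_ge h1, h2⟩
      rw [if_neg h1, if_pos h2, if_pos h3, one_mul]
    · have h3 : ¬(r < j ∧ j ≤ l) := fun hh => h2 hh.2
      rw [if_neg h1, if_neg h2, if_neg h3, mul_one]

/-- The partial product over an empty range. -/
theorem tailProd_self (w : Fin D → ℝ) (r : Fin D) : tailProd w r r = 1 :=
  prod_eq_one fun j _ => by
    have : ¬(r < j ∧ j ≤ r) := fun hh => absurd (lt_of_lt_of_le hh.1 hh.2) (lt_irrefl _)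
    simp [this]

/-- A partial product over a non-empty range is small if the coordinates are. -/
theorem tailProd_le {w : Fin D → ℝ} {ρ : ℝ} (hρ : ρ ≤ 1) (hw : ∀ j, 0 ≤ w j ∧ w j ≤ ρ)
    {r l : Fin D} (h : r < l) : tailProd w r l ≤ ρ := by
  have hρ0 : 0 ≤ ρ := (hw l).1.trans (hw l).2
  unfold tailProd
  rw [← mul_prod_erase univ _ (mem_univ l)]
  have h1 : (if r < l ∧ l ≤ l then w l else 1) ≤ ρ := by simp [h, (hw l).2]
  have h2 : (∏ j ∈ univ.erase l, if r < j ∧ j ≤ l then w j else (1 : ℝ)) ≤ 1 :=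
    prod_le_one (fun j _ => by split_ifs <;> [exact (hw j).1; exact zero_le_one])
      fun j _ => by split_ifs <;> [exact (hw j).2.trans hρ; exact le_rfl]
  have h3 : (0 : ℝ) ≤ ∏ j ∈ univ.erase l, if r < j ∧ j ≤ l then w j else (1 : ℝ) :=
    prod_nonneg fun j _ => by split_ifs <;> [exact (hw j).1; exact zero_le_one]
  calc (if r < l ∧ l ≤ l then w l else 1) * ∏ j ∈ univ.erase l, (if r < j ∧ j ≤ l then w j else (1 : ℝ))
      ≤ ρ * 1 := mul_le_mul h1 h2 h3 hρ0
    _ = ρ := mul_one ρ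

/-- Partial products are at most one if the coordinates are. -/
theorem tailProd_le_one {w : Fin D → ℝ} (hw : ∀ j, 0 ≤ w j ∧ w j ≤ 1) (r l : Fin D) :
    tailProd w r l ≤ 1 :=
  prod_le_one (fun j _ => by split_ifs <;> [exact (hw j).1; exact zero_le_one])
    fun j _ => by split_ifs <;> [exact (hw j).2; exact le_rfl]

/-- **Nested products decrease along the levels** when the later coordinates are at most one. -/
theorem cum_le_cum {w : Fin D → ℝ} (hw : ∀ j, 0 ≤ w j ∧ w j ≤ 1) {r l : Fin D} (h : r ≤ l) :
    cum w l ≤ cum w r := by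
  rw [cum_eq_mul_tailProd w h]
  exact mul_le_of_le_one_right (cum_nonneg (fun j => (hw j).1) r) (tailProd_le_one hw r l)

/-- A later nested product is smaller by the factor `ρ`. -/
theorem cum_le_cum_mul {w : Fin D → ℝ} {ρ : ℝ} (hρ : ρ ≤ 1) (hw : ∀ j, 0 ≤ w j ∧ w j ≤ ρ)
    {r l : Fin D} (h : r < l) : cum w l ≤ cum w r * ρ := by
  rw [cum_eq_mul_tailProd w h.le]
  exact mul_le_mul_of_nonneg_left (tailProd_le hρ hw h) (cum_nonneg (fun j => (hw j).1) r)

/-- The first nested product. -/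
theorem cum_zero (w : Fin (D + 1) → ℝ) : cum w 0 = w 0 := by
  unfold cum
  rw [Fin.prod_univ_succ]
  simp [Fin.succ_ne_zero]

/-- A nested product is at most the first coordinate if the other coordinates are at most one. -/
theorem cum_le_head {w : Fin (D + 1) → ℝ} (hw : ∀ j, 0 ≤ w j ∧ w j ≤ 1) (l : Fin (D + 1)) :
    cum w l ≤ w 0 := by
  rw [← cum_zero w]
  exact cum_le_cum hw (Fin.zero_le _)

/-- The `Fin.cons` recursion of nested products, first level. -/
theorem cum_cons_zero (t : ℝ) (w : Fin D → ℝ) : cum (Fin.cons t w : Fin (D + 1) → ℝ) 0 = t := by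
  rw [cum_zero]; rfl

/-- The `Fin.cons` recursion of nested products, later levels. -/
theorem cum_cons_succ (t : ℝ) (w : Fin D → ℝ) (l : Fin D) :
    cum (Fin.cons t w : Fin (D + 1) → ℝ) l.succ = t * cum w l := by
  unfold cum
  rw [Fin.prod_univ_succ]
  simp only [Fin.cons_zero, Fin.cons_succ, Fin.succ_le_succ_iff]
  simp

/-- Changing one coordinate: earlier nested products are unchanged. -/
theorem cum_update_of_lt (w : Fin D → ℝ) (r : Fin D) (x : ℝ) {l : Fin D} (h : l < r) :
    cum (Function.update w r x) l = cum w l := by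
  unfold cum
  refine prod_congr rfl fun j _ => ?_
  by_cases hj : j ≤ l
  · have hjr : j ≠ r := fun hh => absurd (hh ▸ hj) (not_le.2 h)
    simp [hj, Function.update_of_ne hjr]
  · simp [hj]

/-- Changing one coordinate by a factor: later nested products change by the same factor. -/
theorem cum_update_of_le (w : Fin D → ℝ) (r : Fin D) (σ : ℝ) {l : Fin D} (h : r ≤ l) :
    cum (Function.update w r (σ * w r)) l = σ * cum w l := by
  unfold cum
  rw [← mul_prod_erase univ _ (mem_univ r), ← mul_prod_erase univ (fun j => if j ≤ l then w j else 1)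
    (mem_univ r)]
  have h1 : (∏ j ∈ univ.erase r, if j ≤ l then Function.update w r (σ * w r) j else (1 : ℝ)) =
      ∏ j ∈ univ.erase r, if j ≤ l then w j else (1 : ℝ) :=
    prod_congr rfl fun j hj => by rw [Function.update_of_ne (ne_of_mem_erase hj)]
  rw [h1]
  simp [h]
  ring

/-! ### Nested affine values and the sign lemma -/

/-- The nested affine value `c₀ + ∑ cum w l · α l`. -/
def nlin (c₀ : ℝ) (α : Fin D → ℝ) (w : Fin D → ℝ) : ℝ := c₀ + ∑ l, cum w l * α l

/-- The sum of the nested terms is controlled by the first nested product (levels `≥ 1` small). -/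
theorem abs_sum_cum_le {w : Fin (D + 1) → ℝ} (hw : ∀ j, 0 ≤ w j ∧ w j ≤ 1) (α : Fin (D + 1) → ℝ) :
    |∑ l, cum w l * α l| ≤ w 0 * ∑ l, |α l| := by
  calc |∑ l, cum w l * α l| ≤ ∑ l, |cum w l * α l| := abs_sum_le_sum_abs _ _
    _ ≤ ∑ l, w 0 * |α l| := sum_le_sum fun l _ => by
        rw [abs_mul, abs_of_nonneg (cum_nonneg (fun j => (hw j).1) l)]
        exact mul_le_mul_of_nonneg_right (cum_le_head hw l) (abs_nonneg _)
    _ = w 0 * ∑ l, |α l| := by rw [mul_sum]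

/-- The tail beyond the level `r` is controlled by `cum w r · ρ`. -/
theorem abs_sum_tail_le {w : Fin D → ℝ} {ρ : ℝ} (hρ : ρ ≤ 1) (hw : ∀ j, 0 ≤ w j ∧ w j ≤ ρ)
    (α : Fin D → ℝ) (r : Fin D) :
    |∑ l, if r < l then cum w l * α l else 0| ≤ cum w r * ρ * ∑ l, |α l| := by
  have hρ0 : ∀ j, 0 ≤ w j ∧ w j ≤ 1 := fun j => ⟨(hw j).1, (hw j).2.trans hρ⟩
  have hc : 0 ≤ cum w r * ρ :=
    mul_nonneg (cum_nonneg (fun j => (hw j).1) r) ((hw r).1.trans (hw r).2)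
  have _h := hρ0
  calc |∑ l, if r < l then cum w l * α l else 0|
      ≤ ∑ l, |if r < l then cum w l * α l else 0| := abs_sum_le_sum_abs _ _
    _ ≤ ∑ l, cum w r * ρ * |α l| := sum_le_sum fun l _ => by
        split_ifs with h
        · rw [abs_mul, abs_of_nonneg (cum_nonneg (fun j => (hw j).1) l)]
          exact mul_le_mul_of_nonneg_right (cum_le_cum_mul hρ hw h) (abs_nonneg _)
        · rw [abs_zero]; exact mul_nonneg hc (abs_nonneg _)
    _ = cum w r * ρ * ∑ l, |α l| := by rw [mul_sum]

/-- Splitting the nested sum at the first non-zero coefficient. -/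
theorem sum_cum_eq_of_low_zero {α : Fin D → ℝ} {r : Fin D} (hlow : ∀ l, l < r → α l = 0)
    (w : Fin D → ℝ) :
    (∑ l, cum w l * α l) = cum w r * α r + ∑ l, if r < l then cum w l * α l else 0 := by
  have h : ∀ l, cum w l * α l = (if l = r then cum w r * α r else 0) +
      (if r < l then cum w l * α l else 0) := by
    intro l
    rcases lt_trichotomy l r with hl | hl | hl
    · rw [if_neg hl.ne, if_neg (not_lt.2 hl.le), hlow l hl]; ring
    · subst hl
      rw [if_pos rfl, if_neg (lt_irrefl _), add_zero]
    · rw [if_neg hl.ne', if_pos hl, zero_add]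
  rw [sum_congr rfl fun l _ => h l, sum_add_distrib, sum_ite_eq' univ r, if_pos (Finset.mem_univ r)]

/-- **The sign lemma for one nested affine form.** On all boxes `∏ (0, ρ]` with `ρ` small the nested
affine value is either always positive or always non-positive. -/
theorem sign_nest (c₀ : ℝ) (α : Fin (D + 1) → ℝ) : ∃ ρ : ℝ, 0 < ρ ∧
    ((∀ w : Fin (D + 1) → ℝ, (∀ j, 0 < w j ∧ w j ≤ ρ) → 0 < nlin c₀ α w) ∨
     (∀ w : Fin (D + 1) → ℝ, (∀ j, 0 < w j ∧ w j ≤ ρ) → nlin c₀ α w ≤ 0)) := by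
  set A : ℝ := ∑ l, |α l| with hA
  have hA0 : 0 ≤ A := sum_nonneg fun l _ => abs_nonneg _
  by_cases hc : c₀ ≠ 0
  · -- the constant term decides
    refine ⟨min 1 (|c₀| / (2 * (A + 1))), lt_min one_pos (by positivity), ?_⟩
    have key : ∀ w : Fin (D + 1) → ℝ, (∀ j, 0 < w j ∧ w j ≤ min 1 (|c₀| / (2 * (A + 1)))) →
        |∑ l, cum w l * α l| < |c₀| := by
      intro w hw
      have hw1 : ∀ j, 0 ≤ w j ∧ w j ≤ 1 := fun j => ⟨(hw j).1.le, (hw j).2.trans (min_le_left _ _)⟩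
      have h1 := abs_sum_cum_le hw1 α
      have h2 : w 0 ≤ |c₀| / (2 * (A + 1)) := (hw 0).2.trans (min_le_right _ _)
      have h3 : w 0 * A ≤ |c₀| / (2 * (A + 1)) * A := mul_le_mul_of_nonneg_right h2 hA0
      have h4 : |c₀| / (2 * (A + 1)) * A < |c₀| := by
        rw [div_mul_eq_mul_div, div_lt_iff₀ (by positivity)]
        nlinarith [abs_pos.2 hc]
      linarith
    rcases lt_or_gt_of_ne hc with hneg | hpos
    · refine Or.inr fun w hw => ?_
      have h := key w hw
      unfold nlin
      rw [abs_of_neg hneg] at h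
      linarith [le_abs_self (∑ l, cum w l * α l)]
    · refine Or.inl fun w hw => ?_
      have h := key w hw
      unfold nlin
      rw [abs_of_pos hpos] at h
      linarith [neg_abs_le (∑ l, cum w l * α l)]
  push Not at hc
  subst hc
  by_cases hall : ∀ l, α l = 0
  · refine ⟨1, one_pos, Or.inr fun w _ => ?_⟩
    simp [nlin, hall]
  push Not at hall
  -- the first non-zero slope decides
  classical
  set S : Finset (Fin (D + 1)) := univ.filter fun l => α l ≠ 0 with hS
  have hSne : S.Nonempty := by
    obtain ⟨l, hl⟩ := hall
    exact ⟨l, by simp [hS, hl]⟩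
  set r : Fin (D + 1) := S.min' hSne with hr
  have hrS : r ∈ S := min'_mem S hSne
  have hαr : α r ≠ 0 := by simpa [hS] using hrS
  have hlow : ∀ l, l < r → α l = 0 := by
    intro l hl
    by_contra hne
    have hlS : l ∈ S := by simp [hS, hne]
    exact absurd (min'_le S l hlS) (not_le.2 (hr ▸ hl))
  refine ⟨min 1 (|α r| / (2 * (A + 1))), lt_min one_pos (by positivity), ?_⟩
  have key : ∀ w : Fin (D + 1) → ℝ, (∀ j, 0 < w j ∧ w j ≤ min 1 (|α r| / (2 * (A + 1)))) →
      |∑ l, if r < l then cum w l * α l else 0| < cum w r * |α r| := by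
    intro w hw
    have hρ1 : min 1 (|α r| / (2 * (A + 1))) ≤ 1 := min_le_left _ _
    have hw' : ∀ j, 0 ≤ w j ∧ w j ≤ min 1 (|α r| / (2 * (A + 1))) := fun j => ⟨(hw j).1.le, (hw j).2⟩
    have h1 := abs_sum_tail_le hρ1 hw' α r
    have hcr : 0 < cum w r := cum_pos (fun j => (hw j).1) r
    have h2 : cum w r * min 1 (|α r| / (2 * (A + 1))) * A ≤ cum w r * (|α r| / (2 * (A + 1)) * A) := by
      rw [mul_assoc]
      exact mul_le_mul_of_nonneg_left (mul_le_mul_of_nonneg_right (min_le_right _ _) hA0) hcr.le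
    have h3 : |α r| / (2 * (A + 1)) * A < |α r| := by
      rw [div_mul_eq_mul_div, div_lt_iff₀ (by positivity)]
      nlinarith [abs_pos.2 hαr]
    have h4 : cum w r * (|α r| / (2 * (A + 1)) * A) < cum w r * |α r| := mul_lt_mul_of_pos_left h3 hcr
    linarith
  rcases lt_or_gt_of_ne hαr with hneg | hpos
  · refine Or.inr fun w hw => le_of_lt ?_
    have h := key w hw
    have hcr : 0 < cum w r := cum_pos (fun j => (hw j).1) r
    unfold nlin
    rw [zero_add, sum_cum_eq_of_low_zero hlow, abs_of_neg hneg] at *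
    have := le_abs_self (∑ l, if r < l then cum w l * α l else 0)
    nlinarith
  · refine Or.inl fun w hw => ?_
    have h := key w hw
    unfold nlin
    rw [zero_add, sum_cum_eq_of_low_zero hlow, abs_of_pos hpos] at *
    have := neg_abs_le (∑ l, if r < l then cum w l * α l else 0)
    nlinarith

/-- **The sign lemma for finitely many nested affine forms.** On a common small box, either every
form is positive or one of them is non-positive. -/
theorem sign_nest_family {m : ℕ} (c₀ : Fin m → ℝ) (α : Fin m → Fin (D + 1) → ℝ) :
    ∃ ρ : ℝ, 0 < ρ ∧
    ((∀ w : Fin (D + 1) → ℝ, (∀ j, 0 < w j ∧ w j ≤ ρ) → ∀ i, 0 < nlin (c₀ i) (α i) w) ∨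
     (∃ i, ∀ w : Fin (D + 1) → ℝ, (∀ j, 0 < w j ∧ w j ≤ ρ) → nlin (c₀ i) (α i) w ≤ 0)) := by
  choose ρ hρ hsign using fun i => sign_nest (c₀ i) (α i)
  by_cases hm : m = 0
  · subst hm
    exact ⟨1, one_pos, Or.inl fun w _ i => i.elim0⟩
  have hne : (univ : Finset (Fin m)).Nonempty := univ_nonempty_iff.2 (Fin.pos_iff_nonempty.1
    (Nat.pos_of_ne_zero hm))
  set ρ₀ : ℝ := univ.inf' hne ρ with hρ₀
  have hρ₀le : ∀ i, ρ₀ ≤ ρ i := fun i => inf'_le _ (mem_univ i)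
  have hρ₀pos : 0 < ρ₀ := by
    obtain ⟨i, -, hi⟩ := exists_mem_eq_inf' hne ρ
    rw [hρ₀, hi]; exact hρ i
  refine ⟨ρ₀, hρ₀pos, ?_⟩
  by_cases hall : ∀ i, ∀ w : Fin (D + 1) → ℝ, (∀ j, 0 < w j ∧ w j ≤ ρ i) → 0 < nlin (c₀ i) (α i) w
  · exact Or.inl fun w hw i => hall i w fun j => ⟨(hw j).1, (hw j).2.trans (hρ₀le i)⟩
  · push Not at hall
    obtain ⟨i, w, hw, hle⟩ := hall
    refine Or.inr ⟨i, fun w' hw' => ?_⟩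
    rcases hsign i with h | h
    · exact absurd (h w hw) (not_lt.2 hle)
    · exact h w' fun j => ⟨(hw' j).1, (hw' j).2.trans (hρ₀le i)⟩

/-! ### The monomial factor of a wall -/

/-- The regular factor of a nested linear value whose coefficients vanish below the level `r`. -/
def unitOf (α : Fin D → ℝ) (r : Fin D) (w : Fin D → ℝ) : ℝ :=
  α r + ∑ l, if r < l then tailProd w r l * α l else 0

/-- **The monomial factor.** If `α l = 0` for `l < r` then `∑ cum w l · α l = cum w r · unitOf α r w`. -/
theorem nest_factor {α : Fin D → ℝ} {r : Fin D} (hlow : ∀ l, l < r → α l = 0) (w : Fin D → ℝ) :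
    (∑ l, cum w l * α l) = cum w r * unitOf α r w := by
  rw [sum_cum_eq_of_low_zero hlow, unitOf, mul_add, mul_sum]
  congr 1
  refine sum_congr rfl fun l _ => ?_
  split_ifs with h
  · rw [cum_eq_mul_tailProd w h.le]; ring
  · rw [mul_zero]

/-- The regular factor is continuous. -/
theorem continuous_unitOf (α : Fin D → ℝ) (r : Fin D) : Continuous (unitOf α r) := by
  unfold unitOf tailProd
  refine continuous_const.add (continuous_finsetSum _ fun l _ => ?_)
  split_ifs
  · exact (continuous_finsetProd _ fun j _ => by
      split_ifs <;> [exact continuous_apply j; exact continuous_const]).mul continuous_const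
  · exact continuous_const

/-- The regular factor at the corner. -/
theorem unitOf_zero (α : Fin D → ℝ) (r : Fin D) : unitOf α r 0 = α r := by
  unfold unitOf
  rw [add_eq_left]
  refine sum_eq_zero fun l _ => ?_
  split_ifs with h
  · have : tailProd (0 : Fin D → ℝ) r l = 0 := by
      unfold tailProd
      exact prod_eq_zero (mem_univ l) (by simp [h])
    rw [this, zero_mul]
  · rfl

/-- **Two-sided bounds for the regular factor near the corner.** -/
theorem unitOf_bounds {α : Fin D → ℝ} {r : Fin D} (hαr : α r ≠ 0) :
    ∃ ρ : ℝ, 0 < ρ ∧ ∀ w : Fin D → ℝ, (∀ j, 0 ≤ w j ∧ w j ≤ ρ) →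
      |α r| / 2 ≤ |unitOf α r w| ∧ |unitOf α r w| ≤ 2 * |α r| := by
  set A : ℝ := ∑ l, |α l| with hA
  have hA0 : 0 ≤ A := sum_nonneg fun l _ => abs_nonneg _
  refine ⟨min 1 (|α r| / (2 * (A + 1))), lt_min one_pos (by positivity), fun w hw => ?_⟩
  have hρ1 : min 1 (|α r| / (2 * (A + 1))) ≤ 1 := min_le_left _ _
  have htail : |∑ l, if r < l then tailProd w r l * α l else 0| ≤ |α r| / 2 := by
    calc |∑ l, if r < l then tailProd w r l * α l else 0|
        ≤ ∑ l, |if r < l then tailProd w r l * α l else 0| := abs_sum_le_sum_abs _ _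
      _ ≤ ∑ l, min 1 (|α r| / (2 * (A + 1))) * |α l| := sum_le_sum fun l _ => by
          split_ifs with h
          · rw [abs_mul, abs_of_nonneg (tailProd_nonneg (fun j => (hw j).1) r l)]
            exact mul_le_mul_of_nonneg_right (tailProd_le hρ1 hw h) (abs_nonneg _)
          · rw [abs_zero]
            exact mul_nonneg (le_min zero_le_one (by positivity)) (abs_nonneg _)
      _ = min 1 (|α r| / (2 * (A + 1))) * A := by rw [mul_sum]
      _ ≤ |α r| / (2 * (A + 1)) * A := mul_le_mul_of_nonneg_right (min_le_right _ _) hA0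
      _ ≤ |α r| / 2 := by
          rw [div_mul_eq_mul_div, div_le_div_iff₀ (by positivity) two_pos]
          nlinarith [abs_nonneg (α r)]
  have e : unitOf α r w = α r + ∑ l, if r < l then tailProd w r l * α l else 0 := rfl
  constructor
  · have := abs_sub_abs_le_abs_sub (α r) (-(∑ l, if r < l then tailProd w r l * α l else 0))
    rw [abs_neg, sub_neg_eq_add, ← e] at this
    linarith
  · have := abs_add_le (α r) (∑ l, if r < l then tailProd w r l * α l else 0)
    rw [← e] at this
    linarith [abs_nonneg (α r)]

end SepAll

/-- **The sign lemma for nested thin sectors of any depth** (registered part of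
`stub_separateHigh_hH`; literal form of `SepAll.sign_nest_family`): finitely many nested affine
forms `c₀ i + ∑_l (∏_{j ≤ l} w j) · α i l` are, on a common box `∏ (0, ρ]` with `ρ > 0` small,
either all positive or one of them is non-positive there. -/
theorem separateAllHH_nest (D m : ℕ) (c₀ : Fin m → ℝ) (α : Fin m → Fin (D + 1) → ℝ) : ∃ ρ : ℝ, 0 < ρ ∧ ((∀ w : Fin (D + 1) → ℝ, (∀ j, 0 < w j ∧ w j ≤ ρ) → ∀ i, 0 < c₀ i + ∑ l, (∏ j, if j ≤ l then w j else 1) * α i l) ∨ (∃ i, ∀ w : Fin (D + 1) → ℝ, (∀ j, 0 < w j ∧ w j ≤ ρ) → c₀ i + ∑ l, (∏ j, if j ≤ l then w j else 1) * α i l ≤ 0)) := by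
  exact SepAll.sign_nest_family c₀ α

end Summit.KontsevichZagierPeriods.ArrangementNormalForm.JanusBands
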